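import Literature.Algebra.Polynomial.LaguerreCrossSequence
import Mathlib.Tactic
import HarnessLib

/-!
# Generating functions of the Laguerre polynomials (Rota–Kahaner–Odlyzko §11)

G.-C. Rota, D. Kahaner, A. Odlyzko, *Finite operator calculus* (1973), §11, p. 731:

> For the Laguerre polynomials of order `α`, Proposition 5 of Section 5 gives us the generating
> function `Σ_{n≥0} L_n^{(α)} (x)/n! · tⁿ = 1/(1 − t)^{α+1} · e^{xt/(t−1)}`.

and §11, p. 727 (*): the basic Laguerre polynomials `L_n` are the basic set of `K = D/(D − I)`, whose
indicator `K (t) = t/(t − 1)` is its own compositional inverse ("the Laguerre operator `K` satisfies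
`K (K (t)) = t`", p. 729), so that §3 Corollary 3 reads `Σ_n L_n (x) tⁿ/n! = e^{x t/(t−1)}` (the case
`α = −1`).

Typed here (all proved, from the tree's generating-function machinery `BasicSequenceGeneratingFunctions`
— §3 Corollary 3 `IsDeltaOperator.egf_basicSequence_of_subst_eq_X`, §5 Proposition 5
`IsDeltaOperator.egf_sheffer` — and the Laguerre files `LaguerreBasicSequence`, `UmbralInversePairs`,
`LaguerreCrossSequence`): the `K(D)`-indicator of `D` is `K` itself (`indicator_derivative_laguerre`);
`Σ L_n (a) tⁿ/n! = e^{a t/(t−1)}` (`egf_laguerreBasic`); for the integral orders `L_n^{(m−1)} = (I − D)^m L_n`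
(`laguerreSheffer K m n`) `Σ L_n^{(m−1)} (a) tⁿ/n! = (1 − t)^{−m} e^{a t/(t−1)}` (`egf_laguerreSheffer`); and for
an arbitrary order `α ∈ K` (`laguerreOrder α n = (I − D)^{α+1} L_n`, `(I − D)^{λ} = e^{−λF}(D)`,
`F = −log (1 − t)`) `Σ L_n^{(α)} (a) tⁿ/n! = (1 − t)^{−(α+1)} e^{a t/(t−1)}` with
`(1 − t)^{−(α+1)} = e^{(α+1)F} = Σ_k (α+1)^{(k)} tᵏ/k!` (`egf_laguerreOrder`, `egf_laguerreOrder_eq_mk_mul`).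
As everywhere in the tree, an exponential generating function `Σ s_n (x) tⁿ/n!` is typed, for each
scalar `x = a`, as the power series `PowerSeries.mk fun n => (s n).eval a / n!`, and `e^{a u}` is
`PowerSeries.rescale a (PowerSeries.exp K)`.

## References
* [RotaKahanerOdlyzko1973] G.-C. Rota, D. Kahaner, A. Odlyzko, *On the foundations of
  combinatorial theory VIII. Finite operator calculus*, J. Math. Anal. Appl. 42 (1973) 684–760,
  §11, pp. 727–731 (with §3 Corollary 3, p. 693, and §5 Proposition 5, p. 702).
-/

noncomputable section

open Polynomial Finset

namespace Literature.Algebra.Polynomial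

variable (K : Type*) [Field K] [CharZero K]

omit [CharZero K] in
/-- `K (0) = 0` for the Laguerre indicator `K (t) = t/(t − 1)`. [cite: RotaKahanerOdlyzko1973, §11, p. 727] -/
theorem constantCoeff_laguerreSeries :
    PowerSeries.constantCoeff (PowerSeries.X * (PowerSeries.X - 1 : PowerSeries K)⁻¹) = 0 := by
  rw [map_mul, PowerSeries.constantCoeff_X, zero_mul]

/-- **The `K(D)`-indicator of `D` is `K` itself** (`K` is a compositional involution, so the inverse series
`K̄` of §3 Corollary 3 is `K`). [cite: RotaKahanerOdlyzko1973, §11 ("`L_n (L (x)) = xⁿ` … self-inverse"),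
p. 729] [cite: RotaKahanerOdlyzko1973, §3 Corollary 3, p. 693] -/
theorem indicator_derivative_laguerre :
    (isDeltaOperator_diffOp_X_mul_X_sub_one_inv K).indicator derivative =
      PowerSeries.X * (PowerSeries.X - 1 : PowerSeries K)⁻¹ :=
  ((isDeltaOperator_diffOp_X_mul_X_sub_one_inv K).eq_indicator_derivative_of_subst_eq_X rfl
    (constantCoeff_laguerreSeries K) (X_mul_X_sub_one_inv_subst_self K)).symm

/-- **`Σ_n L_n (x) tⁿ/n! = e^{x t/(t−1)}`** — the exponential generating function of the basic Laguerre
polynomials (§3 Corollary 3 for `K = D/(D − I)`; the case `α = −1` of the printed generating function).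
[cite: RotaKahanerOdlyzko1973, §11, p. 731] [cite: RotaKahanerOdlyzko1973, §3 Corollary 3, p. 693] -/
theorem egf_laguerreBasic (a : K) :
    (PowerSeries.mk fun n => (laguerreBasic K n).eval a / (n.factorial : K)) =
      (PowerSeries.rescale a (PowerSeries.exp K)).subst
        (PowerSeries.X * (PowerSeries.X - 1 : PowerSeries K)⁻¹) :=
  (isDeltaOperator_diffOp_X_mul_X_sub_one_inv K).egf_basicSequence_of_subst_eq_X rfl
    (isBasicSequence_laguerreBasic_diffOp K) (constantCoeff_laguerreSeries K) (X_mul_X_sub_one_inv_subst_self K) a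

omit [CharZero K] in
/-- `(1 − u)` at `u = K (t)`: `1 − t/(t − 1) = (1 − t)⁻¹`. [cite: RotaKahanerOdlyzko1973, §11, p. 729] -/
theorem one_sub_X_subst_laguerreSeries :
    (((1 : PowerSeries K) - PowerSeries.X).subst (PowerSeries.X * (PowerSeries.X - 1 : PowerSeries K)⁻¹) :
        PowerSeries K) = ((1 : PowerSeries K) - PowerSeries.X)⁻¹ := by
  have hs := PowerSeries.HasSubst.of_constantCoeff_zero' (constantCoeff_laguerreSeries K)
  rw [PowerSeries.subst_sub hs, powerSeries_one_subst (constantCoeff_laguerreSeries K), PowerSeries.subst_X hs,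
    one_sub_X_mul_X_sub_one_inv]

omit [CharZero K] in
/-- `(1 − u)^m` at `u = K (t)` is `(1 − t)^{−m}`. [cite: RotaKahanerOdlyzko1973, §11, p. 731] -/
theorem one_sub_X_pow_subst_laguerreSeries (m : ℕ) :
    ((((1 : PowerSeries K) - PowerSeries.X) ^ m).subst (PowerSeries.X * (PowerSeries.X - 1 : PowerSeries K)⁻¹) :
        PowerSeries K) = ((1 : PowerSeries K) - PowerSeries.X)⁻¹ ^ m := by
  rw [PowerSeries.subst_pow (PowerSeries.HasSubst.of_constantCoeff_zero' (constantCoeff_laguerreSeries K)),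
    one_sub_X_subst_laguerreSeries]

/-- **`Σ_n L_n^{(α)} (x) tⁿ/n! = (1 − t)^{−(α+1)} e^{x t/(t−1)}` for integral orders** `α = m − 1`
(`L_n^{(m−1)} = (I − D)^m L_n = laguerreSheffer K m n`), by §5 Proposition 5.
[cite: RotaKahanerOdlyzko1973, §11, p. 731] [cite: RotaKahanerOdlyzko1973, §5 Proposition 5, p. 702] -/
theorem egf_laguerreSheffer (m : ℕ) (a : K) :
    (PowerSeries.mk fun n => (laguerreSheffer K m n).eval a / (n.factorial : K)) =
      ((1 : PowerSeries K) - PowerSeries.X)⁻¹ ^ m *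
        (PowerSeries.rescale a (PowerSeries.exp K)).subst
          (PowerSeries.X * (PowerSeries.X - 1 : PowerSeries K)⁻¹) := by
  rw [(isDeltaOperator_diffOp_X_mul_X_sub_one_inv K).egf_sheffer rfl (isBasicSequence_laguerreBasic_diffOp K)
      (((1 : PowerSeries K) - PowerSeries.X) ^ m) (fun n => (laguerreSheffer_eq K m n).symm) a,
    indicator_derivative_laguerre,
    PowerSeries.subst_mul (PowerSeries.HasSubst.of_constantCoeff_zero' (constantCoeff_laguerreSeries K)),
    one_sub_X_pow_subst_laguerreSeries]

/-- **`Σ_n L_n^{(α)} (x) tⁿ/n! = (1 − t)^{−(α+1)} e^{x t/(t−1)}` for an arbitrary order `α ∈ K`**, with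
`(1 − t)^{−(α+1)}` the series `e^{(α+1) F (t)}`, `F (t) = −log (1 − t)` (`L_n^{(α)} = e^{−(α+1)F}(D) L_n`).
[cite: RotaKahanerOdlyzko1973, §11, p. 731] [cite: RotaKahanerOdlyzko1973, §5 Proposition 5, p. 702] -/
theorem egf_laguerreOrder (α a : K) :
    (PowerSeries.mk fun n => (laguerreOrder α n).eval a / (n.factorial : K)) =
      (PowerSeries.rescale (α + 1) (PowerSeries.exp K)).subst (-PowerSeries.rescale (-1) (PowerSeries.log K)) *
        (PowerSeries.rescale a (PowerSeries.exp K)).subst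
          (PowerSeries.X * (PowerSeries.X - 1 : PowerSeries K)⁻¹) := by
  rw [(isDeltaOperator_diffOp_X_mul_X_sub_one_inv K).egf_sheffer rfl (isBasicSequence_laguerreBasic_diffOp K)
      ((PowerSeries.rescale (-(α + 1)) (PowerSeries.exp K)).subst (-PowerSeries.rescale (-1) (PowerSeries.log K)))
      (fun n => by rw [laguerreOrder_eq, expOp_eq]) a,
    indicator_derivative_laguerre,
    PowerSeries.subst_mul (PowerSeries.HasSubst.of_constantCoeff_zero' (constantCoeff_laguerreSeries K)),
    rescale_exp_subst_negLogOneSub_subst_laguerreSeries, neg_neg]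

/-- … with `(1 − t)^{−(α+1)} = Σ_k (α+1)^{(k)} tᵏ/k!` (rising factorials) written out:
`Σ_n L_n^{(α)} (a) tⁿ/n! = (Σ_k (α+1)(α+2)⋯(α+k) tᵏ/k!) · e^{a t/(t−1)}`.
[cite: RotaKahanerOdlyzko1973, §11, pp. 726, 731] -/
theorem egf_laguerreOrder_eq_mk_mul (α a : K) :
    (PowerSeries.mk fun n => (laguerreOrder α n).eval a / (n.factorial : K)) =
      (PowerSeries.mk fun k => (ascPochhammer K k).eval (α + 1) / (k.factorial : K)) *
        (PowerSeries.rescale a (PowerSeries.exp K)).subst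
          (PowerSeries.X * (PowerSeries.X - 1 : PowerSeries K)⁻¹) := by
  rw [egf_laguerreOrder, egf_ascPochhammer]

/-- **`Σ_n M_n^{[λ]} (x) tⁿ/n! = (1 − t)^{−λ} e^{xt}`** — the generating function of the cross-sequence
`M_n^{[λ]} = (I − D)^{−λ} xⁿ` (`laguerreCross`; an Appell-type set `σ(D) xⁿ`, `σ = e^{λF} = (1 − t)^{−λ}`,
so §5 Proposition 5 with `Q = D` gives `σ (t) e^{xt}`).
[cite: RotaKahanerOdlyzko1973, §11, p. 731] [cite: RotaKahanerOdlyzko1973, §5 Proposition 5, p. 702] -/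
theorem egf_laguerreCross (c a : K) :
    (PowerSeries.mk fun n => (laguerreCross c n).eval a / (n.factorial : K)) =
      (PowerSeries.rescale c (PowerSeries.exp K)).subst (-PowerSeries.rescale (-1) (PowerSeries.log K)) *
        PowerSeries.rescale a (PowerSeries.exp K) := by
  rw [isDeltaOperator_derivative.egf_sheffer diffOp_X.symm isBasicSequence_derivative_X_pow
      ((PowerSeries.rescale c (PowerSeries.exp K)).subst (-PowerSeries.rescale (-1) (PowerSeries.log K)))
      (fun n => by rw [laguerreCross_eq, expOp_eq]) a,
    isDeltaOperator_derivative.indicator_self, PowerSeries.X_subst]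

/-- … with `(1 − t)^{−λ} = Σ_k (λ)^{(k)} tᵏ/k!` written out.
[cite: RotaKahanerOdlyzko1973, §11, pp. 726, 731] -/
theorem egf_laguerreCross_eq_mk_mul (c a : K) :
    (PowerSeries.mk fun n => (laguerreCross c n).eval a / (n.factorial : K)) =
      (PowerSeries.mk fun k => (ascPochhammer K k).eval c / (k.factorial : K)) *
        PowerSeries.rescale a (PowerSeries.exp K) := by
  rw [egf_laguerreCross, egf_ascPochhammer]

/-- **"We obtain the following interesting relation": `Σ_n L_n^{(β−n)} (x) tⁿ/n! = (1 + t)^β e^{−xt}`**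
(from `L_n^{(α)} = (−1)ⁿ M_n^{[−α−n]}` and the generating function of `M_n^{[λ]}`), `β ∈ K` arbitrary and
`(1 + t)^β` the series `e^{β log (1 + t)}`. [cite: RotaKahanerOdlyzko1973, §11, p. 731] -/
theorem egf_laguerreOrder_sub_natCast (β a : K) :
    (PowerSeries.mk fun n => (laguerreOrder (β - n) n).eval a / (n.factorial : K)) =
      (PowerSeries.rescale β (PowerSeries.exp K)).subst (PowerSeries.log K) *
        PowerSeries.rescale (-a) (PowerSeries.exp K) := by
  have hF0 : PowerSeries.constantCoeff (-PowerSeries.rescale (-1) (PowerSeries.log K)) = 0 :=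
    constantCoeff_negLogOneSub K
  have hlog0 : PowerSeries.constantCoeff (-PowerSeries.log K) = 0 := by
    rw [map_neg, PowerSeries.constantCoeff_log, neg_zero]
  -- `e^{−βu}` at `u = −log (1 + t)` is `e^{β log (1 + t)}`
  have hkey : ((PowerSeries.rescale (-β) (PowerSeries.exp K)).subst (-PowerSeries.log K) : PowerSeries K) =
      (PowerSeries.rescale β (PowerSeries.exp K)).subst (PowerSeries.log K) := by
    have h1 := rescale_neg_one_subst_eq_subst_neg K (PowerSeries.rescale β (PowerSeries.exp K)) hlog0
    rwa [PowerSeries.rescale_rescale, mul_neg_one, neg_neg] at h1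
  have h := congrArg (PowerSeries.rescale (-1 : K)) (egf_laguerreCross K (-β) a)
  rw [PowerSeries.rescale_mk, map_mul, PowerSeries.rescale_rescale, mul_neg_one,
    ← subst_rescale_eq_rescale_subst _ hF0, map_neg, PowerSeries.rescale_rescale, neg_one_mul, neg_neg,
    PowerSeries.rescale_one, RingHom.id_apply, hkey] at h
  rw [← h]
  ext n
  rw [PowerSeries.coeff_mk, PowerSeries.coeff_mk, laguerreOrder_eq_smul_laguerreCross, sub_add_cancel, eval_smul,
    smul_eq_mul, mul_div_assoc]

/-- The same for a natural exponent, with `(1 + t)^m` an honest power: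
`Σ_n L_n^{(m−n)} (x) tⁿ/n! = (1 + t)^m e^{−xt}`. [cite: RotaKahanerOdlyzko1973, §11, p. 731] -/
theorem egf_laguerreOrder_natCast_sub (m : ℕ) (a : K) :
    (PowerSeries.mk fun n => (laguerreOrder ((m : K) - n) n).eval a / (n.factorial : K)) =
      ((1 : PowerSeries K) + PowerSeries.X) ^ m * PowerSeries.rescale (-a) (PowerSeries.exp K) := by
  rw [egf_laguerreOrder_sub_natCast, ← PowerSeries.exp_pow_eq_rescale_exp,
    PowerSeries.subst_pow (PowerSeries.HasSubst.of_constantCoeff_zero' PowerSeries.constantCoeff_log),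
    exp_subst_log]

end Literature.Algebra.Polynomial
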